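import Literature.NumberTheory.EllipticCurves.Sprung2012.SharpFlatSelmer
import Literature.NumberTheory.EllipticCurves.IwasawaSelmerDualProofs
import Literature.NumberTheory.EllipticCurves.IwasawaSelmerDualUniquenessProofs
import HarnessLib

/-!
# Existence of the ♯/♭ Iwasawa module `X^•(E/K_∞) = Hom(Sel^•(E/K_∞), ℚ/ℤ)` as a `Λ`-module

Sibling PROOF file of `Literature.NumberTheory.EllipticCurves.Sprung2012.SharpFlatSelmer` (Sprung,
J. Number Theory 132 (2012), Def. 7.11 [Sprung2012]: "We also define their Pontryagin duals
`X^*(E/K_∞) := Hom(Sel^*(E/K_∞), ℚ_p/ℤ_p)`"; the `Λ`-action is the one of Kobayashi, Invent. Math. 152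
(2003), p. 2, "`ℤ_p[[Γ]]` acts naturally on the Pontryagin dual", and Greenberg, LNM 1716 §1): the
hypothesis structure `Sprung2012.SharpFlatSelmerDualData W κ γ ι ap g c •` is INHABITED for every
topological generator `γ`. The ♯/♭ copy, line for line, of
`Kobayashi2003/SignedSelmerDualExistsProofs.lean` (`nonempty_signedSelmerDualData`): the generic algebra
`IwasawaDual.IsLocNil.module` on the character group of the `p`-primary, `(γ − 1)`-locally-nilpotent
group `Sel^•(E/K_∞)`. Everything is proved; no named fact is introduced. Non-vacuity of every statement
"`∀ D : SharpFlatSelmerDualData …, …`" (e.g. `Sprung2024.lem59_sharpFlatCharValue_rankZero`).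
HONEST FRAMING (cell `bsd-ssimc`, seat `bsd-ssimc-k3c5-kdot-split`): a construction, not a theorem
about any curve.
-/

noncomputable section

open scoped Classical

universe u

namespace Literature.NumberTheory.EllipticCurves.Sprung2012

open Literature.NumberTheory.EllipticCurves ZpExtension Literature.NumberTheory.EllipticCurves.Sprung2017

variable {K : Type u} [Field K] [NumberField K] (W : WeierstrassCurve K) {p : ℕ} [Fact p.Prime]
  (κ : ZpExtension K p) {E : Type u} [Field E] [Algebra K E]
  (ι : AlgebraicClosure K →ₐ[K] AlgebraicClosure E) (ap : ℤ) (g : Field.absoluteGaloisGroup E)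
  (c : ℕ → localPoints W E) (col : Chroma)

/-- `conj_γ` restricted to an endomorphism of `Sel^•(E/K_∞)` (it preserves the chromatic Selmer group
by `conjH1_mem_sharpFlatSelmerInfty`) — the action through which `Λ` acts on the Pontryagin dual.
[cite: Sprung2012, Def. 7.11 (p. 1503)] [cite: Kobayashi2003, Def. 1.1 (sentence following it, p. 2)] -/
def conjSharpFlatSelmerInfty (γ : Field.absoluteGaloisGroup K) :
    AddMonoid.End (sharpFlatSelmerInfty W κ ι ap g c col) :=
  ((W.conjH1 p κ.kerSubgroup γ).restrict (sharpFlatSelmerInfty W κ ι ap g c col)).codRestrict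
    (sharpFlatSelmerInfty W κ ι ap g c col)
    fun s ↦ conjH1_mem_sharpFlatSelmerInfty W κ ι ap g c col γ s.2

/-- Unfolding `conjSharpFlatSelmerInfty` (definitional). [cite: Sprung2012, Def. 7.11 (p. 1503)] -/
@[simp]
theorem coe_conjSharpFlatSelmerInfty_apply (γ : Field.absoluteGaloisGroup K)
    (s : sharpFlatSelmerInfty W κ ι ap g c col) :
    ((conjSharpFlatSelmerInfty W κ ι ap g c col γ s : sharpFlatSelmerInfty W κ ι ap g c col) :
        W.subgroupH1 p κ.kerSubgroup) = W.conjH1 p κ.kerSubgroup γ s :=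
  rfl

/-- Powers of the restriction are restrictions of `conj_{γ^m}` (`conjH1_one_holds`,
`conjH1_mul_holds`). [cite: Sprung2012, Def. 7.11 (p. 1503)] -/
theorem coe_conjSharpFlatSelmerInfty_pow_apply (γ : Field.absoluteGaloisGroup K) (m : ℕ)
    (s : sharpFlatSelmerInfty W κ ι ap g c col) :
    ((((conjSharpFlatSelmerInfty W κ ι ap g c col γ) ^ m) s :
        sharpFlatSelmerInfty W κ ι ap g c col) : W.subgroupH1 p κ.kerSubgroup) =
      W.conjH1 p κ.kerSubgroup (γ ^ m) s := by
  induction m generalizing s with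
  | zero => rw [pow_zero, pow_zero, AddMonoid.End.one_apply, W.conjH1_one_holds p κ.kerSubgroup,
      AddMonoidHom.id_apply]
  | succ m ih =>
    rw [pow_succ, AddMonoid.End.coe_mul, Function.comp_apply, ih, coe_conjSharpFlatSelmerInfty_apply,
      pow_succ, W.conjH1_mul_holds p κ.kerSubgroup, AddMonoidHom.comp_apply]

/-- **`Sel^•(E/K_∞)` is `p`-primary and `T = γ − 1` is locally nilpotent on it** (the hypotheses
`IwasawaDual.IsLocNil` of the generic `Λ`-action), for `γ` a topological generator — statements about
all of `H¹(K_∞, E[p^∞])` (`exists_pow_smul_subgroupH1_ker_eq_zero`, `exists_conjH1_pow_prime_pow_eq`)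
with the algebra lemma `IwasawaDual.pow_mul_prime_pow_apply_eq_zero`.
[cite: Sprung2012, Def. 7.11 (p. 1503)] [cite: GreenbergLNM1716, §1 (p. 60)] -/
theorem isLocNil_conjSharpFlatSelmerInfty_sub_one {γ : Field.absoluteGaloisGroup K}
    (hγ : κ.IsTopGenerator γ) :
    IwasawaDual.IsLocNil p (conjSharpFlatSelmerInfty W κ ι ap g c col γ - 1) := by
  have htor : ∀ s : sharpFlatSelmerInfty W κ ι ap g c col, ∃ k : ℕ, p ^ k • s = 0 := fun s ↦ by
    obtain ⟨k, hk⟩ := W.exists_pow_smul_subgroupH1_ker_eq_zero κ (s : W.subgroupH1 p κ.kerSubgroup)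
    exact ⟨k, Subtype.ext (by rw [AddSubgroupClass.coe_nsmul]; exact hk)⟩
  refine ⟨htor, fun s ↦ ?_⟩
  obtain ⟨a, ha⟩ := W.exists_conjH1_pow_prime_pow_eq κ hγ (s : W.subgroupH1 p κ.kerSubgroup)
  obtain ⟨k, hk⟩ := htor s
  have hφ : ((conjSharpFlatSelmerInfty W κ ι ap g c col γ) ^ p ^ a) s = s :=
    Subtype.ext (by rw [coe_conjSharpFlatSelmerInfty_pow_apply]; exact ha)
  exact ⟨k * p ^ a, IwasawaDual.pow_mul_prime_pow_apply_eq_zero (Fact.out : p.Prime) _ a hφ hk⟩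

/-- **The Iwasawa module `X^•(E/K_∞) = Hom(Sel^•(E/K_∞), ℚ/ℤ)` with its `Λ`-module structure**
(`T = γ − 1`, constants through `ℤ_p → ℤ/pᵏ`) packaged as a `SharpFlatSelmerDualData`:
`X = (Sel^•_∞ →+ AddCircle 1)`, `toDual = id`, module structure `IsLocNil.module`, `conj_mem` by
`conjH1_mem_sharpFlatSelmerInfty`. [cite: Sprung2012, Def. 7.11 (p. 1503)] [cite: Kobayashi2003, Def. 1.1 (sentence following it, p. 2)] -/
def sharpFlatSelmerDualData {γ : Field.absoluteGaloisGroup K} (hγ : κ.IsTopGenerator γ) :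
    SharpFlatSelmerDualData W κ γ ι ap g c col :=
  { X := sharpFlatSelmerInfty W κ ι ap g c col →+ AddCircle (1 : ℚ)
    module := (isLocNil_conjSharpFlatSelmerInfty_sub_one W κ ι ap g c col hγ).module
    conj_mem := fun s hs ↦ conjH1_mem_sharpFlatSelmerInfty W κ ι ap g c col γ hs
    toDual := AddMonoidHom.id _
    bijective := Function.bijective_id
    toDual_T_smul := fun x s ↦ by
      show (isLocNil_conjSharpFlatSelmerInfty_sub_one W κ ι ap g c col hγ).smulFun PowerSeries.X x s =
        x _ - x s
      rw [(isLocNil_conjSharpFlatSelmerInfty_sub_one W κ ι ap g c col hγ).smulFun_X_apply,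
        IwasawaDual.End_sub_apply, AddMonoid.End.one_apply, map_sub]
      rfl
    toDual_C_smul := fun a x s k hk ↦ by
      show (isLocNil_conjSharpFlatSelmerInfty_sub_one W κ ι ap g c col hγ).smulFun
          (PowerSeries.C a) x s = _
      exact (isLocNil_conjSharpFlatSelmerInfty_sub_one W κ ι ap g c col hγ).smulFun_C_apply a x hk }

/-- **Existence of the ♯/♭ Iwasawa module**: for `γ` a topological generator of `Gal(K_∞/K)` the
Pontryagin dual of `Sel^•(E/K_∞)` carries a `Λ`-module structure with `T = γ − 1`, i.e.
`SharpFlatSelmerDualData W κ γ ι ap g c •` is inhabited. Non-vacuity of every statement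
"`∀ D : SharpFlatSelmerDualData …, …`". [cite: Sprung2012, Def. 7.11 (p. 1503)] [cite: Kobayashi2003, Def. 1.1 (sentence following it, p. 2)] -/
theorem nonempty_sharpFlatSelmerDualData {γ : Field.absoluteGaloisGroup K}
    (hγ : κ.IsTopGenerator γ) : Nonempty (SharpFlatSelmerDualData W κ γ ι ap g c col) :=
  ⟨sharpFlatSelmerDualData W κ ι ap g c col hγ⟩

/-! ## APPEND (cell `bsd-print-x8`, seat ty2 g2, 2026-08-27): the carrier is inhabited for EVERY `γ ∈ Γ_K`

Tribunal hygiene (D-0034 t-carrier). The kernel's carrier probe asks `Nonempty (SharpFlatSelmerDualData W κ γ ι ap g c •)`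
over the DATA the type depends on — `W, κ, γ, ι, ap, g, c, •` — WITHOUT the Prop hypothesis `κ.IsTopGenerator γ` that
`nonempty_sharpFlatSelmerDualData` asks for; so every crux binding `D : SharpFlatSelmerDualData …` (route `PrintX8`
items 20304 / 20622, the K3 ♯/♭ items, `Sprung2024.lem59_…`) read `carrier-unverified:…:binder:D` (PrintX8 t0,
2026-08-27T13:53Z). The hypothesis is not needed: the action of `Γ_K` on the discrete `p`-primary group
`H¹(K_∞, E[p^∞])` is continuous through `Γ_K / ker κ ≅ ℤ_p`, so `conj_γ − 1` is locally nilpotent for ANY `γ`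
(`WeierstrassCurve.exists_conjH1_pow_prime_pow_eq'`, the tree's hypothesis-free twin of Greenberg's "every element is
killed by `Tⁿ`"). Two theorems, no definition, nothing asserted about any curve. -/

/-- **`Sel^•(E/K_∞)` is `p`-primary and `conj_γ − 1` is locally nilpotent on it, for EVERY `γ ∈ Γ_K`** (version of
`isLocNil_conjSharpFlatSelmerInfty_sub_one` without the hypothesis `κ γ = 1`): "fixed by `γ^{p^a}`"
(`WeierstrassCurve.exists_conjH1_pow_prime_pow_eq'`, any `γ`) and "killed by `p^k`" give "killed by
`(γ − 1)^{k p^a}`" (`IwasawaDual.pow_mul_prime_pow_apply_eq_zero`). Greenberg, LNM 1716 §1 (p. 60: "a torsion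
`ℤ_p`-module, every element of which is killed by `Tⁿ` for some `n`"); Serre, *Galois Cohomology* I.§2.6 (b)
(continuity of the action on the discrete module). [cite: GreenbergLNM1716, §1 (p. 60)] [cite: Sprung2012, Def. 7.11 (p. 1503)] -/
theorem isLocNil_conjSharpFlatSelmerInfty_sub_one' (γ : Field.absoluteGaloisGroup K) :
    IwasawaDual.IsLocNil p (conjSharpFlatSelmerInfty W κ ι ap g c col γ - 1) := by
  have htor : ∀ s : sharpFlatSelmerInfty W κ ι ap g c col, ∃ k : ℕ, p ^ k • s = 0 := fun s ↦ by
    obtain ⟨k, hk⟩ := W.exists_pow_smul_subgroupH1_ker_eq_zero κ (s : W.subgroupH1 p κ.kerSubgroup)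
    exact ⟨k, Subtype.ext (by rw [AddSubgroupClass.coe_nsmul]; exact hk)⟩
  refine ⟨htor, fun s ↦ ?_⟩
  obtain ⟨a, ha⟩ := W.exists_conjH1_pow_prime_pow_eq' κ γ (s : W.subgroupH1 p κ.kerSubgroup)
  obtain ⟨k, hk⟩ := htor s
  have hφ : ((conjSharpFlatSelmerInfty W κ ι ap g c col γ) ^ p ^ a) s = s :=
    Subtype.ext (by rw [coe_conjSharpFlatSelmerInfty_pow_apply]; exact ha)
  exact ⟨k * p ^ a, IwasawaDual.pow_mul_prime_pow_apply_eq_zero (Fact.out : p.Prime) _ a hφ hk⟩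

/-- **The ♯/♭ carrier is inhabited unconditionally**: for EVERY `γ ∈ Γ_K` (topological generator or not) the
Pontryagin dual `Hom(Sel^•(E/K_∞), ℚ/ℤ)` with `T = conj_γ − 1` (`IwasawaDual.IsLocNil.module` of
`isLocNil_conjSharpFlatSelmerInfty_sub_one'`) is a term of `SharpFlatSelmerDualData W κ γ ι ap g c •`; hence
`Nonempty`. This is the hypothesis-free form the tribunal's carrier probe (`intros; exact?` over the data binders
only) can use; for a topological generator it is the module of `sharpFlatSelmerDualData` (same construction).
[cite: Sprung2012, Def. 7.11 (p. 1503)] [cite: Kobayashi2003, Def. 1.1 (sentence following it, p. 2)] -/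
theorem nonempty_sharpFlatSelmerDualData' (γ : Field.absoluteGaloisGroup K) :
    Nonempty (SharpFlatSelmerDualData W κ γ ι ap g c col) :=
  ⟨{ X := sharpFlatSelmerInfty W κ ι ap g c col →+ AddCircle (1 : ℚ)
     module := (isLocNil_conjSharpFlatSelmerInfty_sub_one' W κ ι ap g c col γ).module
     conj_mem := fun s hs ↦ conjH1_mem_sharpFlatSelmerInfty W κ ι ap g c col γ hs
     toDual := AddMonoidHom.id _
     bijective := Function.bijective_id
     toDual_T_smul := fun x s ↦ by
       show (isLocNil_conjSharpFlatSelmerInfty_sub_one' W κ ι ap g c col γ).smulFun PowerSeries.X x s =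
         x _ - x s
       rw [(isLocNil_conjSharpFlatSelmerInfty_sub_one' W κ ι ap g c col γ).smulFun_X_apply,
         IwasawaDual.End_sub_apply, AddMonoid.End.one_apply, map_sub]
       rfl
     toDual_C_smul := fun a x s k hk ↦ by
       show (isLocNil_conjSharpFlatSelmerInfty_sub_one' W κ ι ap g c col γ).smulFun
           (PowerSeries.C a) x s = _
       exact (isLocNil_conjSharpFlatSelmerInfty_sub_one' W κ ι ap g c col γ).smulFun_C_apply a x hk }⟩

/-- **Route-shaped instance over `ℚ`** (the exact binder shape of route `PrintX8`'s items and of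
`Theorems.SprungSharpFlatMainConjecture`: `ι = closureEmb (v.adicCompletion ℚ)`, `ap = a_p(W)`): for every place
`v`, every `g`, every `c`, every colour and EVERY `γ`, `SharpFlatSelmerDualData W κ γ (closureEmb …) (W.frobeniusTrace p) g c •`
is inhabited. [cite: Sprung2012, Def. 7.11 (p. 1503)] -/
theorem nonempty_sharpFlatSelmerDualData_rat (W : WeierstrassCurve ℚ) [W.IsGloballyMinimal] {p : ℕ} [Fact p.Prime]
    (κ : ZpExtension ℚ p) (γ : Field.absoluteGaloisGroup ℚ)
    (v : IsDedekindDomain.HeightOneSpectrum (NumberField.RingOfIntegers ℚ))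
    (g : Field.absoluteGaloisGroup (v.adicCompletion ℚ)) (c : ℕ → localPoints W (v.adicCompletion ℚ))
    (col : Chroma) :
    Nonempty (SharpFlatSelmerDualData W κ γ (closureEmb (K := ℚ) (v.adicCompletion ℚ)) (W.frobeniusTrace p) g c col) :=
  nonempty_sharpFlatSelmerDualData' W κ _ _ g c col γ

end Literature.NumberTheory.EllipticCurves.Sprung2012

end
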